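import Literature.Analysis.FluidPDE.BiotSavartNewtonKernel
import Literature.Analysis.FluidPDE.NewtonPotentialHolder
import Literature.Analysis.Convolution.YoungInequality
import HarnessLib

/-!
# The gradient-Newtonian potential `∫ φ(z) ∇Γ(y − z) dz` of a `C¹` compactly supported density

Analysis/FluidPDE support file (theorems only) for the discharge of the named fact
`Literature.Analysis.FluidPDE.bradshawTsai2017_lemma_2_5` (`PeriodicLerayExistence.lean`;
Bradshaw–Tsai, Ann. Henri Poincaré 18 (2017) = arXiv:1510.07504 [BT1], Lemma 2.5), whose
divergence correction is `w = −∫ (∇ξ·U₀)(z) ∇Γ(· − z) dz` with the tree's Newtonian kernel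
`Γ = newtonKernel = −(4π|·|)⁻¹`.

## References

* D. Gilbarg, N. S. Trudinger, *Elliptic partial differential equations of second order*
  (2001), (2.17)–(2.18), Lemmas 4.1–4.2. [GilbargTrudinger2001]
* Z. Bradshaw, T.-P. Tsai, Ann. Henri Poincaré 18 (2017) = arXiv:1510.07504, proof of Lemma 2.5
  [BradshawTsai2017AHP].
-/

noncomputable section

open MeasureTheory Set Filter Topology Function Metric InnerProductSpace
open scoped ENNReal NNReal RealInnerProductSpace Laplacian Convolution

namespace Literature.Analysis.FluidPDE

namespace NewtonGradPotential

/-! ### The kernel `∇Γ` -/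

/-- `⟪∇Γ(z), v⟫ = DΓ(z) v`. [folklore] -/
theorem inner_gradient_newtonKernel (z v : (EuclideanSpace ℝ (Fin 3))) :
    ⟪gradient newtonKernel z, v⟫ = fderiv ℝ newtonKernel z v := by
  rw [gradient, InnerProductSpace.toDual_symm_apply]

/-- `‖∇Γ(z)‖ = ‖DΓ(z)‖`. [folklore] -/
theorem norm_gradient_newtonKernel (z : (EuclideanSpace ℝ (Fin 3))) :
    ‖gradient newtonKernel z‖ = ‖fderiv ℝ newtonKernel z‖ := by
  rw [gradient, LinearIsometryEquiv.norm_map]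

/-- `‖∇Γ(z)‖ ≤ (4π|z|²)⁻¹` for all `z` (both sides vanish at the origin). [folklore] -/
theorem norm_gradient_newtonKernel_le (z : (EuclideanSpace ℝ (Fin 3))) :
    ‖gradient newtonKernel z‖ ≤ (4 * Real.pi * ‖z‖ ^ 2)⁻¹ := by
  rw [norm_gradient_newtonKernel]
  exact norm_fderiv_newtonKernel_le z

/-- `‖∇Γ(z)‖ ≤ (4π)⁻¹ |z|^{-2}` in `rpow` form. [folklore] -/
theorem norm_gradient_newtonKernel_le_rpow (z : (EuclideanSpace ℝ (Fin 3))) :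
    ‖gradient newtonKernel z‖ ≤ (4 * Real.pi)⁻¹ * ‖z‖ ^ (-(2 : ℝ)) := by
  refine (norm_gradient_newtonKernel_le z).trans (le_of_eq ?_)
  rw [Real.rpow_neg (norm_nonneg _), show (2 : ℝ) = ((2 : ℕ) : ℝ) by norm_num,
    Real.rpow_natCast, mul_inv]

/-- `∇Γ` is measurable. [folklore] -/
theorem measurable_gradient_newtonKernel : Measurable (gradient newtonKernel) := by
  have : gradient newtonKernel =
      fun z => (InnerProductSpace.toDual ℝ (EuclideanSpace ℝ (Fin 3))).symm (fderiv ℝ newtonKernel z) := rfl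
  rw [this]
  exact (InnerProductSpace.toDual ℝ (EuclideanSpace ℝ (Fin 3))).symm.continuous.measurable.comp
    (measurable_fderiv ℝ newtonKernel)

/-- `∇Γ ∈ L¹_loc((EuclideanSpace ℝ (Fin 3)))` (`|∇Γ(z)| ≤ (4π)⁻¹|z|⁻²`, `2 < 3`). [cite: GilbargTrudinger2001, Lemma 4.1] -/
theorem locallyIntegrable_gradient_newtonKernel :
    LocallyIntegrable (gradient newtonKernel) volume :=
  locallyIntegrable_of_norm_le_rpow (by rw [finrank_euclideanSpace_fin]; norm_num)
    (C := (4 * Real.pi)⁻¹) (α := 2) (by rw [finrank_euclideanSpace_fin]; norm_num)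
    (Eventually.of_forall norm_gradient_newtonKernel_le_rpow)
    measurable_gradient_newtonKernel.aestronglyMeasurable

/-! ### The `C¹_c` form of Poisson's equation: `∑ᵢ ∫ ∂ᵢΓ(y − x) ∂ᵢG(x) dx = G(y)` -/

/-- One integration by parts against the regularised kernel: for `G ∈ C¹_c` and a smooth `Φ`,
`∫ ∂ₐΦ(y − x) ∂ₐG(x) dx = ∫ ∂ₐ∂ₐΦ(y − x) G(x) dx`. [folklore] -/
theorem integral_fderiv_comp_sub_mul_fderiv_eq {Φ G : (EuclideanSpace ℝ (Fin 3)) → ℝ} (hΦ : ContDiff ℝ 2 Φ)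
    (hG : ContDiff ℝ 1 G) (hGc : HasCompactSupport G) (y a : (EuclideanSpace ℝ (Fin 3))) :
    ∫ x, fderiv ℝ Φ (y - x) a * fderiv ℝ G x a =
      ∫ x, fderiv ℝ (fun w => fderiv ℝ Φ w a) (y - x) a * G x := by
  set g : (EuclideanSpace ℝ (Fin 3)) → ℝ := fun w => fderiv ℝ Φ w a with hg
  have hg1 : ContDiff ℝ 1 g := (hΦ.fderiv_right (m := 1) le_rfl).clm_apply contDiff_const
  set k : (EuclideanSpace ℝ (Fin 3)) → ℝ := fun x => g (y - x) with hk
  have hk1 : ContDiff ℝ 1 k := hg1.comp (contDiff_const.sub contDiff_id)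
  have hP : ContDiff ℝ 1 fun x => k x * G x := hk1.mul hG
  have hPc : HasCompactSupport fun x => k x * G x := hGc.mul_left
  have h0 := FluidPDE.integral_fderiv_apply_eq_zero hP hPc a
  have hpt : ∀ x, fderiv ℝ (fun x => k x * G x) x a =
      -(fderiv ℝ g (y - x) a) * G x + k x * fderiv ℝ G x a := by
    intro x
    rw [fderiv_fun_mul (hk1.differentiable one_ne_zero x) (hG.differentiable one_ne_zero x)]
    simp only [_root_.add_apply, _root_.FunLike.coe_smul, Pi.smul_apply, smul_eq_mul]
    rw [hk, fderiv_comp_const_sub g y x]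
    simp only [_root_.neg_apply]
    ring
  simp_rw [hpt] at h0
  have i1 : Integrable fun x => -(fderiv ℝ g (y - x) a) * G x :=
    ((((hg1.continuous_fderiv one_ne_zero).clm_apply continuous_const).comp
      (continuous_const.sub continuous_id)).neg.mul hG.continuous).integrable_of_hasCompactSupport
      hGc.mul_left
  have i2 : Integrable fun x => k x * fderiv ℝ G x a :=
    (hk1.continuous.mul ((hG.continuous_fderiv one_ne_zero).clm_apply continuous_const))
      |>.integrable_of_hasCompactSupport (hGc.fderiv_apply (𝕜 := ℝ) a).mul_left
  rw [integral_add i1 i2] at h0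
  have : ∫ x, k x * fderiv ℝ G x a = -∫ x, -(fderiv ℝ g (y - x) a) * G x := by linarith
  rw [this, ← integral_neg]
  refine integral_congr_ae (Eventually.of_forall fun x => ?_)
  simp only [neg_mul, neg_neg]

/-- Summing over an orthonormal frame: for `G ∈ C¹_c` and the regularised Newtonian kernel
`Φ_ε`, `∑ᵢ ∫ ∂ᵢΦ_ε(y − x) ∂ᵢG(x) dx = ∫ λ_{ε/2,ε}(z) G(y − z) dz`, `λ = ΔΦ_ε`. [folklore] -/
theorem sum_integral_fderiv_newtonReg_mul_fderiv_eq {ι : Type*} [Fintype ι]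
    (b : OrthonormalBasis ι ℝ (EuclideanSpace ℝ (Fin 3))) {G : (EuclideanSpace ℝ (Fin 3)) → ℝ} (hG : ContDiff ℝ 1 G)
    (hGc : HasCompactSupport G) {ε : ℝ} (hε : 0 < ε) (y : (EuclideanSpace ℝ (Fin 3))) :
    ∑ i, ∫ x, fderiv ℝ (newtonReg ε) (y - x) (b i) * fderiv ℝ G x (b i) =
      ∫ z, newtonFarLaplacian (ε / 2) ε z * G (y - z) := by
  have hΦ : ContDiff ℝ 2 (newtonReg ε) := contDiff_newtonReg ε
  have step1 : ∀ i, ∫ x, fderiv ℝ (newtonReg ε) (y - x) (b i) * fderiv ℝ G x (b i) =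
      ∫ x, fderiv ℝ (fun w => fderiv ℝ (newtonReg ε) w (b i)) (y - x) (b i) * G x := fun i =>
    integral_fderiv_comp_sub_mul_fderiv_eq hΦ hG hGc y (b i)
  simp_rw [step1]
  have hcont : ∀ i, Continuous fun x =>
      fderiv ℝ (fun w => fderiv ℝ (newtonReg ε) w (b i)) (y - x) (b i) := fun i =>
    (FluidPDE.continuous_fderiv_fderiv_apply hΦ (b i) (b i)).comp
      (continuous_const.sub continuous_id)
  have hint : ∀ i, Integrable fun x =>
      fderiv ℝ (fun w => fderiv ℝ (newtonReg ε) w (b i)) (y - x) (b i) * G x := fun i =>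
    ((hcont i).mul hG.continuous).integrable_of_hasCompactSupport hGc.mul_left
  rw [← integral_finsetSum _ fun i _ => hint i]
  have hlap : ∀ x, ∑ i, fderiv ℝ (fun w => fderiv ℝ (newtonReg ε) w (b i)) (y - x) (b i) * G x =
      (Δ (newtonReg ε)) (y - x) * G x := by
    intro x
    rw [← Finset.sum_mul, laplacian_eq_sum_fderiv_fderiv b hΦ (y - x)]
  simp_rw [hlap, laplacian_newtonReg hε]
  have h := (integral_sub_left_eq_self
    (fun x => newtonFarLaplacian (ε / 2) ε (y - x) * G x) volume y).symm
  simpa only [sub_sub_cancel] using h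

/-- **Poisson's equation for `C¹_c` densities, first-order form.** For `G ∈ C¹_c((EuclideanSpace ℝ (Fin 3)))`, every
orthonormal frame `(bᵢ)` and every `y`,
`∑ᵢ ∫ ∂ᵢΓ(y − x) ∂ᵢG(x) dx = G(y)` — i.e. `div (∇Γ ⋆ G) = ΔΓ ⋆ G = G` with one derivative on
each factor, the form available when `G` is only `C¹` (Gilbarg–Trudinger (2.17)–(2.18),
Lemma 4.1). Proof without boundary integrals: replace `Γ` by the regularised kernel `Φ_ε`
(`newtonReg`), integrate by parts once (`sum_integral_fderiv_newtonReg_mul_fderiv_eq`: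
the right side becomes the mollification of `G` by the unit-mass bump `λ_{ε/2,ε} = ΔΦ_ε`), and let
`ε → 0⁺` on both sides (`tendsto_integral_fderiv_newtonReg_smul`,
`tendsto_integral_newtonFarLaplacian_smul`). [cite: GilbargTrudinger2001, Lemma 4.1] -/
theorem sum_integral_fderiv_newtonKernel_mul_fderiv_eq {ι : Type*} [Fintype ι]
    (b : OrthonormalBasis ι ℝ (EuclideanSpace ℝ (Fin 3))) {G : (EuclideanSpace ℝ (Fin 3)) → ℝ} (hG : ContDiff ℝ 1 G)
    (hGc : HasCompactSupport G) (y : (EuclideanSpace ℝ (Fin 3))) :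
    ∑ i, ∫ x, fderiv ℝ newtonKernel (y - x) (b i) * fderiv ℝ G x (b i) = G y := by
  -- the left-hand sides converge
  have hL : Tendsto (fun ε => ∑ i, ∫ x, fderiv ℝ (newtonReg ε) (y - x) (b i) * fderiv ℝ G x (b i))
      (𝓝[>] 0) (𝓝 (∑ i, ∫ x, fderiv ℝ newtonKernel (y - x) (b i) * fderiv ℝ G x (b i))) := by
    refine tendsto_finsetSum _ fun i _ => ?_
    have h := tendsto_integral_fderiv_newtonReg_smul (F := ℝ)
      ((hG.continuous_fderiv one_ne_zero).clm_apply continuous_const)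
      (hGc.fderiv_apply (𝕜 := ℝ) (b i)) y (b i)
    simpa only [smul_eq_mul] using h
  -- the right-hand sides converge to `G y`
  have hR : Tendsto (fun ε => ∫ z, newtonFarLaplacian (ε / 2) ε z * G (y - z)) (𝓝[>] 0)
      (𝓝 (G y)) := by
    have hφ : Continuous fun z : (EuclideanSpace ℝ (Fin 3)) => G (y - z) := hG.continuous.comp (continuous_const.sub
      continuous_id)
    have h := tendsto_integral_newtonFarLaplacian_smul (r₀ := 1 / 2) (r₁ := 1) (by norm_num)
      (by norm_num) hφ
    simp only [sub_zero, smul_eq_mul, mul_one] at h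
    refine h.congr' ?_
    filter_upwards [self_mem_nhdsWithin] with ε _
    rw [show ε * (1 / 2) = ε / 2 by ring]
  have hR' : Tendsto (fun ε => ∑ i, ∫ x, fderiv ℝ (newtonReg ε) (y - x) (b i) *
      fderiv ℝ G x (b i)) (𝓝[>] 0) (𝓝 (G y)) := by
    refine hR.congr' ?_
    filter_upwards [self_mem_nhdsWithin] with ε hε
    exact (sum_integral_fderiv_newtonReg_mul_fderiv_eq b hG hGc hε y).symm
  exact tendsto_nhds_unique hL hR'

/-! ### The potential `φ ⋆ ∇Γ` of a `C¹_c` density: integral form, derivative, divergence -/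

/-- Unfolding the convolution: `(φ ⋆ ∇Γ)(y) = ∫ φ(t) ∇Γ(y − t) dt`. [folklore] -/
theorem convolution_gradient_newtonKernel_apply (φ : (EuclideanSpace ℝ (Fin 3)) → ℝ) (y : (EuclideanSpace ℝ (Fin 3))) :
    (φ ⋆[ContinuousLinearMap.lsmul ℝ ℝ, volume] gradient newtonKernel) y =
      ∫ t, φ t • gradient newtonKernel (y - t) := by
  rw [convolution_def]
  simp only [ContinuousLinearMap.lsmul_apply]

/-- The potential integrand `t ↦ φ(t) ∇Γ(y − t)` is integrable for continuous compactly
supported `φ`. [folklore] -/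
theorem integrable_smul_gradient_newtonKernel {φ : (EuclideanSpace ℝ (Fin 3)) → ℝ} (hφ : Continuous φ)
    (hφc : HasCompactSupport φ) (y : (EuclideanSpace ℝ (Fin 3))) :
    Integrable (fun t => φ t • gradient newtonKernel (y - t)) volume := by
  have h := hφc.convolutionExists_left (ContinuousLinearMap.lsmul ℝ ℝ) hφ
    locallyIntegrable_gradient_newtonKernel y
  simpa only [ConvolutionExistsAt, ContinuousLinearMap.lsmul_apply] using h

/-- **Derivatives fall on the density** (Gilbarg–Trudinger, Lemma 4.1): for `φ ∈ C¹_c`,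
`∂ᵥ(φ ⋆ ∇Γ)(y) = ((∂ᵥφ) ⋆ ∇Γ)(y)`. [cite: GilbargTrudinger2001, Lemma 4.1] -/
theorem fderiv_convolution_gradient_newtonKernel_apply {φ : (EuclideanSpace ℝ (Fin 3)) → ℝ} (hφ : ContDiff ℝ 1 φ)
    (hφc : HasCompactSupport φ) (y v : (EuclideanSpace ℝ (Fin 3))) :
    fderiv ℝ (φ ⋆[ContinuousLinearMap.lsmul ℝ ℝ, volume] gradient newtonKernel) y v =
      ((fun t => fderiv ℝ φ t v) ⋆[ContinuousLinearMap.lsmul ℝ ℝ, volume]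
        gradient newtonKernel) y :=
  fderiv_convolution_lsmul_apply hφ hφc locallyIntegrable_gradient_newtonKernel y v

/-- `φ ⋆ ∇Γ` is `C¹` for `φ ∈ C¹_c`. [cite: GilbargTrudinger2001, Lemma 4.1] -/
theorem contDiff_convolution_gradient_newtonKernel {φ : (EuclideanSpace ℝ (Fin 3)) → ℝ} {n : ℕ∞} (hφ : ContDiff ℝ n φ)
    (hφc : HasCompactSupport φ) :
    ContDiff ℝ n (φ ⋆[ContinuousLinearMap.lsmul ℝ ℝ, volume] gradient newtonKernel) :=
  hφc.contDiff_convolution_left _ hφ locallyIntegrable_gradient_newtonKernel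

/-- **`div (φ ⋆ ∇Γ) = φ` for `φ ∈ C¹_c((EuclideanSpace ℝ (Fin 3)))`** (`∇Γ ⋆` is a right inverse of the divergence on
`C¹_c`; equivalently `Δ(Γ ⋆ φ) = φ` with the derivatives distributed one on each factor):
`div (φ ⋆ ∇Γ)(y) = ∑ᵢ ∫ ∂ᵢφ(t) ∂ᵢΓ(y − t) dt = φ(y)` by
`fderiv_convolution_gradient_newtonKernel_apply` and
`sum_integral_fderiv_newtonKernel_mul_fderiv_eq`. [cite: GilbargTrudinger2001, Lemma 4.1] -/
theorem divergence_convolution_gradient_newtonKernel {φ : (EuclideanSpace ℝ (Fin 3)) → ℝ} (hφ : ContDiff ℝ 1 φ)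
    (hφc : HasCompactSupport φ) (y : (EuclideanSpace ℝ (Fin 3))) :
    VectorCalculus.divergence
        (φ ⋆[ContinuousLinearMap.lsmul ℝ ℝ, volume] gradient newtonKernel) y = φ y := by
  set b := stdOrthonormalBasis ℝ (EuclideanSpace ℝ (Fin 3))
  rw [divergence_eq_sum_inner_fderiv b]
  have hcont : ∀ i, Continuous fun t => fderiv ℝ φ t (b i) := fun i =>
    (hφ.continuous_fderiv one_ne_zero).clm_apply continuous_const
  have hcs : ∀ i, HasCompactSupport fun t => fderiv ℝ φ t (b i) := fun i =>
    hφc.fderiv_apply (𝕜 := ℝ) (b i)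
  have step : ∀ i, ⟪b i, fderiv ℝ (φ ⋆[ContinuousLinearMap.lsmul ℝ ℝ, volume]
      gradient newtonKernel) y (b i)⟫ =
      ∫ t, fderiv ℝ newtonKernel (y - t) (b i) * fderiv ℝ φ t (b i) := by
    intro i
    rw [fderiv_convolution_gradient_newtonKernel_apply hφ hφc,
      convolution_gradient_newtonKernel_apply,
      ← integral_inner (integrable_smul_gradient_newtonKernel (hcont i) (hcs i) y)]
    refine integral_congr_ae (Eventually.of_forall fun t => ?_)
    dsimp only
    rw [real_inner_smul_right, real_inner_comm, inner_gradient_newtonKernel, mul_comm]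
  simp_rw [step]
  exact sum_integral_fderiv_newtonKernel_mul_fderiv_eq b hφ hφc y

/-! ### Densities depending on a parameter: joint regularity and the parameter derivative -/

/-- **Joint `Cⁿ` regularity of a parametric potential.** If `Φ : ℝ × (EuclideanSpace ℝ (Fin 3)) → ℝ` is jointly `Cⁿ`
and `Φ(s, ·)` vanishes off a fixed ball for every `s`, then `(s, y) ↦ (Φ(s,·) ⋆ ∇Γ)(y)` is
jointly `Cⁿ` (Mathlib's `contDiffOn_convolution_left_with_param`, `∇Γ ∈ L¹_loc`). [folklore] -/
theorem contDiff_convolution_gradient_newtonKernel_param {Φ : ℝ → (EuclideanSpace ℝ (Fin 3)) → ℝ} {n : ℕ∞}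
    (hΦ : ContDiff ℝ n (uncurry Φ)) {ρ : ℝ} (hΦρ : ∀ s z, ρ < ‖z‖ → Φ s z = 0) :
    ContDiff ℝ n fun q : ℝ × (EuclideanSpace ℝ (Fin 3)) =>
      (Φ q.1 ⋆[ContinuousLinearMap.lsmul ℝ ℝ, volume] gradient newtonKernel) q.2 := by
  have h := contDiffOn_convolution_left_with_param (μ := (volume : Measure (EuclideanSpace ℝ (Fin 3))))
    (ContinuousLinearMap.lsmul ℝ ℝ) (f := gradient newtonKernel) (n := n) (g := Φ) (s := univ)
    (k := closedBall (0 : (EuclideanSpace ℝ (Fin 3))) ρ) isOpen_univ (isCompact_closedBall 0 ρ)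
    (fun p x _ hx => hΦρ p x (by simpa [mem_closedBall_zero_iff] using hx))
    locallyIntegrable_gradient_newtonKernel
    (by rw [univ_prod_univ]; exact hΦ.contDiffOn)
  rw [univ_prod_univ] at h
  exact contDiffOn_univ.1 h

/-- The `s`-derivative of a jointly `C¹` density with uniformly bounded support vanishes off
that support. [folklore] -/
theorem fderiv_uncurry_apply_eq_zero_of_lt {Φ : ℝ → (EuclideanSpace ℝ (Fin 3)) → ℝ} (hΦ : ContDiff ℝ 1 (uncurry Φ))
    {ρ : ℝ} (hΦρ : ∀ s z, ρ < ‖z‖ → Φ s z = 0) {z : (EuclideanSpace ℝ (Fin 3))} (hz : ρ < ‖z‖) (s : ℝ) :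
    fderiv ℝ (uncurry Φ) (s, z) (1, 0) = 0 := by
  have h1 := ((hΦ.differentiable one_ne_zero (s, z)).hasFDerivAt).comp_hasDerivAt s
      ((hasDerivAt_id s).prodMk (hasDerivAt_const s z))
  have h2 : HasDerivAt (fun s' => uncurry Φ (s', z)) 0 s := by
    have : (fun s' => uncurry Φ (s', z)) = fun _ => (0 : ℝ) := funext fun s' => hΦρ s' z hz
    rw [this]
    exact hasDerivAt_const s 0
  exact h1.unique h2

/-- The slice `s ↦ Φ(s, z)` of a jointly `C¹` density has derivative `DΦ(s,z)(1,0)`. [folklore] -/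
theorem hasDerivAt_slice {Φ : ℝ → (EuclideanSpace ℝ (Fin 3)) → ℝ} (hΦ : ContDiff ℝ 1 (uncurry Φ)) (s : ℝ) (z : (EuclideanSpace ℝ (Fin 3))) :
    HasDerivAt (fun s' => Φ s' z) (fderiv ℝ (uncurry Φ) (s, z) (1, 0)) s := by
  have h := ((hΦ.differentiable one_ne_zero (s, z)).hasFDerivAt).comp_hasDerivAt s
    ((hasDerivAt_id s).prodMk (hasDerivAt_const s z))
  exact h

/-- **Differentiation in the parameter under the integral.** For `Φ` jointly `C¹` with
`Φ(s, ·)` vanishing off a fixed ball, `s ↦ (Φ(s,·) ⋆ ∇Γ)(y)` has derivative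
`(∂ₛΦ(s₀,·) ⋆ ∇Γ)(y)`, `∂ₛΦ(s, z) = DΦ(s,z)(1,0)` (dominated convergence: on `|s − s₀| < 1` the
`s`-derivative of the integrand is bounded by `sup|∂ₛΦ| · (4π)⁻¹ 1_{|y−z|<r}|y − z|⁻²`). [folklore] -/
theorem hasDerivAt_convolution_gradient_newtonKernel_param {Φ : ℝ → (EuclideanSpace ℝ (Fin 3)) → ℝ}
    (hΦ : ContDiff ℝ 1 (uncurry Φ)) {ρ : ℝ} (hΦρ : ∀ s z, ρ < ‖z‖ → Φ s z = 0) (s₀ : ℝ)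
    (y : (EuclideanSpace ℝ (Fin 3))) :
    HasDerivAt (fun s => (Φ s ⋆[ContinuousLinearMap.lsmul ℝ ℝ, volume] gradient newtonKernel) y)
      (((fun z => fderiv ℝ (uncurry Φ) (s₀, z) (1, 0)) ⋆[ContinuousLinearMap.lsmul ℝ ℝ, volume]
        gradient newtonKernel) y) s₀ := by
  set Φ' : ℝ → (EuclideanSpace ℝ (Fin 3)) → ℝ := fun s z => fderiv ℝ (uncurry Φ) (s, z) (1, 0) with hΦ'
  have hΦ'c : Continuous (uncurry Φ') :=
    (hΦ.continuous_fderiv one_ne_zero).clm_apply continuous_const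
  -- continuity and support of the slices
  have hsl : ∀ s, Continuous (Φ s) := fun s =>
    hΦ.continuous.comp (continuous_const.prodMk continuous_id)
  have hsl' : ∀ s, Continuous (Φ' s) := fun s =>
    hΦ'c.comp (continuous_const.prodMk continuous_id)
  have hsupp : ∀ s, HasCompactSupport (Φ s) := fun s =>
    HasCompactSupport.intro (isCompact_closedBall (0 : (EuclideanSpace ℝ (Fin 3))) ρ) fun z hz =>
      hΦρ s z (by simpa [mem_closedBall_zero_iff] using hz)
  have hsupp' : ∀ s, HasCompactSupport (Φ' s) := fun s =>
    HasCompactSupport.intro (isCompact_closedBall (0 : (EuclideanSpace ℝ (Fin 3))) ρ) fun z hz =>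
      fderiv_uncurry_apply_eq_zero_of_lt hΦ hΦρ (by simpa [mem_closedBall_zero_iff] using hz) s
  -- a uniform bound for `∂ₛΦ` on `[s₀ - 1, s₀ + 1] × B̄(0, ρ)`
  obtain ⟨M₀, hM₀⟩ : ∃ M, ∀ p ∈ closedBall s₀ 1 ×ˢ closedBall (0 : (EuclideanSpace ℝ (Fin 3))) ρ, ‖uncurry Φ' p‖ ≤ M :=
    ((isCompact_closedBall s₀ 1).prod (isCompact_closedBall 0 ρ)).exists_bound_of_continuousOn
      hΦ'c.continuousOn
  set M : ℝ := max M₀ 0 with hMdef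
  have hM : ∀ p ∈ closedBall s₀ 1 ×ˢ closedBall (0 : (EuclideanSpace ℝ (Fin 3))) ρ, ‖uncurry Φ' p‖ ≤ M := fun p hp =>
    (hM₀ p hp).trans (le_max_left _ _)
  have hM0 : 0 ≤ M := le_max_right _ _
  have hbound_pt : ∀ s ∈ ball s₀ 1, ∀ z, ‖Φ' s z‖ ≤ M := by
    intro s hs z
    by_cases hz : ‖z‖ ≤ ρ
    · exact hM (s, z) ⟨mem_closedBall.2 (le_of_lt (mem_ball.1 hs)), mem_closedBall_zero_iff.2 hz⟩
    · rw [show Φ' s z = 0 from fderiv_uncurry_apply_eq_zero_of_lt hΦ hΦρ (not_le.1 hz) s,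
        norm_zero]
      exact hM0
  -- the dominating function
  set r : ℝ := ‖y‖ + |ρ| + 1 with hr
  have hr0 : 0 < r := by positivity
  set bound : (EuclideanSpace ℝ (Fin 3)) → ℝ := fun z => M * ((4 * Real.pi)⁻¹ * nearProfile₂ r ‖y - z‖) with hbound
  have hbound_int : Integrable bound volume :=
    (((integrable_nearProfile₂_norm hr0).comp_sub_left y).const_mul _).const_mul M
  have hker : ∀ z, ‖z‖ ≤ ρ → ‖gradient newtonKernel (y - z)‖ ≤
      (4 * Real.pi)⁻¹ * nearProfile₂ r ‖y - z‖ := by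
    intro z hz
    have hyz : ‖y - z‖ < r := by
      calc ‖y - z‖ ≤ ‖y‖ + ‖z‖ := norm_sub_le _ _
        _ ≤ ‖y‖ + |ρ| := by linarith [le_abs_self ρ]
        _ < r := by rw [hr]; linarith
    refine (norm_gradient_newtonKernel_le _).trans (le_of_eq ?_)
    unfold nearProfile₂
    rw [if_pos hyz, mul_inv]
  have key := hasDerivAt_integral_of_dominated_loc_of_deriv_le (μ := (volume : Measure (EuclideanSpace ℝ (Fin 3))))
    (F := fun s z => Φ s z • gradient newtonKernel (y - z))
    (F' := fun s z => Φ' s z • gradient newtonKernel (y - z)) (x₀ := s₀)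
    (ball_mem_nhds s₀ one_pos)
    (Eventually.of_forall fun s =>
      (integrable_smul_gradient_newtonKernel (hsl s) (hsupp s) y).aestronglyMeasurable)
    (integrable_smul_gradient_newtonKernel (hsl s₀) (hsupp s₀) y)
    (integrable_smul_gradient_newtonKernel (hsl' s₀) (hsupp' s₀) y).aestronglyMeasurable
    (bound := bound) ?_ hbound_int ?_
  · have e1 : (fun s => (Φ s ⋆[ContinuousLinearMap.lsmul ℝ ℝ, volume] gradient newtonKernel) y) =
        fun s => ∫ z, Φ s z • gradient newtonKernel (y - z) :=
      funext fun s => convolution_gradient_newtonKernel_apply (Φ s) y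
    rw [e1, convolution_gradient_newtonKernel_apply]
    exact key.2
  · refine Eventually.of_forall fun z s hs => ?_
    rw [norm_smul]
    by_cases hz : ‖z‖ ≤ ρ
    · exact mul_le_mul (hbound_pt s hs z) (hker z hz) (norm_nonneg _) hM0
    · rw [show Φ' s z = 0 from fderiv_uncurry_apply_eq_zero_of_lt hΦ hΦρ (not_le.1 hz) s,
        norm_zero, zero_mul]
      exact mul_nonneg hM0 (mul_nonneg (by positivity) (nearProfile₂_nonneg _ _))
  · refine Eventually.of_forall fun z s _ => ?_
    exact (hasDerivAt_slice hΦ s z).smul_const _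

end NewtonGradPotential

end Literature.Analysis.FluidPDE

end
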